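import Summits.Schanuel.Schanuel.Theorems.ZilberEacStripEscape
import HarnessLib

/-!
# Logarithmic strips, II-b: zeros converging to the corrected roots (vanishing radii)

HONEST FRAMING.  Cell `pub-schanuel` (Zilber's Exponential-Algebraic Closedness, case ladder;
host summit Schanuel), seat 2, gen 17.  A bookkeeping corollary of engine v4
(`exists_strip_zeros`, which allows any fixed persistence radius `ε ∈ (0, 1]`): choosing the
radius `1/(m+1)` at a stage `k_m ≥ m` gives zeros `z₀(k_m) + u_m/α` with `‖u_m‖ < 1/(m+1)`, i.e.
`u_m → 0` along stages `k_m → ∞` (no diagonal argument needed).  This is the input for the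
second-order growth analysis of the fibre curves with `Re(lc(p)·i^{deg p}) = 0` (HANDOFF O65),
where `Re z` must be known up to `o(1)` rather than `O(1)`.  NOT Schanuel's conjecture (neither
used nor implied; EAC ⇏ SC); `EC(3,2)` stays OPEN; Mantova–Masser's question stays OPEN in general.
-/

noncomputable section

open Filter Topology Metric Set Complex Polynomial
open Literature.ModelTheory.Zilber

set_option linter.dupNamespace false

namespace Summit.Schanuel.Schanuel.Theorems

/-- **Zeros converging to the corrected roots.**  Under the hypotheses of `exists_strip_zeros`
there are stages `k_m ≥ m` and `u_m` with `‖u_m‖ < 1/(m+1)`, `‖u_m‖ < ‖α‖`, such that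
`z₀(k_m) + u_m/α` is a zero of `Σ_j q_j(z)e^{e_j(αz+β)} + E(z)`. (new) -/
theorem exists_strip_zeros_seq {ι : Type*} (α β : ℂ) (hα : α ≠ 0)
    (J : Finset ι) (q : ι → Polynomial ℂ) (e : ι → ℕ) (μ κ : ℝ)
    (hκ : ∀ j ∈ J, ((q j).natDegree : ℝ) + μ * e j ≤ κ)
    {θ : ℂ} (hθ0 : θ ≠ 0)
    (hθ : (∑ j ∈ J.filter (fun j => ((q j).natDegree : ℝ) + μ * e j = κ),
        Polynomial.C (q j).leadingCoeff * Polynomial.X ^ (e j)).eval θ = 0)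
    (hQ : (∑ j ∈ J.filter (fun j => ((q j).natDegree : ℝ) + μ * e j = κ),
        Polynomial.C (q j).leadingCoeff * Polynomial.X ^ (e j)) ≠ 0)
    (z₀ Lg : ℕ → ℂ) (hLz : ∀ k, exp (Lg k) = z₀ k)
    (hz₀θ : ∀ k, exp (α * z₀ k + β) = θ * exp ((μ : ℂ) * Lg k))
    (hz₀norm : Tendsto (fun k => ‖z₀ k‖) atTop atTop)
    (E : ℂ → ℂ) (hE : Differentiable ℂ E)
    (hEs : ∀ η : ℝ, 0 < η → ∀ᶠ k in atTop, ∀ u ∈ closedBall (0 : ℂ) 1,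
      ‖E (z₀ k + u / α)‖ ≤ η * ‖exp ((κ : ℂ) * Lg k)‖) :
    ∃ (k : ℕ → ℕ) (u : ℕ → ℂ), (∀ m, m ≤ k m) ∧ (∀ m, ‖u m‖ < 1 / ((m : ℝ) + 1)) ∧
      (∀ m, ‖u m‖ < ‖α‖) ∧
      ∀ m, (∑ j ∈ J, (q j).eval (z₀ (k m) + u m / α) * exp (α * (z₀ (k m) + u m / α) + β) ^ (e j)) +
        E (z₀ (k m) + u m / α) = 0 := by
  have hstage : ∀ m : ℕ, ∃ k : ℕ, m ≤ k ∧ ∃ u ∈ ball (0 : ℂ) (min (1 / ((m : ℝ) + 1)) ‖α‖),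
      (∑ j ∈ J, (q j).eval (z₀ k + u / α) * exp (α * (z₀ k + u / α) + β) ^ (e j)) +
        E (z₀ k + u / α) = 0 := by
    intro m
    have hε0 : 0 < 1 / ((m : ℝ) + 1) := by positivity
    have hε1 : 1 / ((m : ℝ) + 1) ≤ 1 := by
      rw [div_le_one (by positivity)]
      have : (0 : ℝ) ≤ m := Nat.cast_nonneg m
      linarith
    have h := exists_strip_zeros α β hα J q e μ κ hκ hθ0 hθ hQ z₀ Lg hLz hz₀θ hz₀norm E hE hEs
      hε0 hε1
    obtain ⟨K, hK⟩ := eventually_atTop.1 h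
    exact ⟨max m K, le_max_left _ _, hK _ (le_max_right _ _)⟩
  choose k hkm u hu hu0 using hstage
  refine ⟨k, u, hkm, fun m => ?_, fun m => ?_, hu0⟩
  · have := hu m
    rw [mem_ball, dist_zero_right] at this
    exact this.trans_le (min_le_left _ _)
  · have := hu m
    rw [mem_ball, dist_zero_right] at this
    exact this.trans_le (min_le_right _ _)

/-- The stages of `exists_strip_zeros_seq` tend to infinity. [folklore] -/
theorem tendsto_of_le_self {k : ℕ → ℕ} (hk : ∀ m, m ≤ k m) : Tendsto k atTop atTop :=
  tendsto_atTop_mono hk tendsto_id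

end Summit.Schanuel.Schanuel.Theorems
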